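import Summits.QuantumFields.BalabanUV.T4Continuum.Support.NE9LinSizeEndRemSpecies
import Summits.QuantumFields.BalabanUV.T4Continuum.Support.NE9LinSizeEndMultiScaleBudget

/-!
# NE9LinSizeEndRemSpeciesBudget — N2-sexies: the leaf-01 budget AT THE DISPLAYED SPECIES — E5′-REM
(`NE9LinSizeEndRemSpecies.torus_termSize_ne9_and_fadingMemory_of_linSizeDischargers_remSpecies`, p213078) IN PRINT-SHAPED LETTERS,
and the species' FADING THRESHOLD read off the resulting exponential-free rate letter — cell `pub-balaban`, T4-DAG §2 node U3 / §6 NE9;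
own-initiative lineage census item of unit `b2b-balaban-t4-ne9-formalise-leaf-01` (gen 5; journal CLAIM l.9308), the sixth of the N2
series (N2-bis p208845, N2-ter p209831/p210131/p210458, N2-quater p211624, N2-quinquies p212549).

HONEST FRAMING (T4-DAG PAGE 1).  Rung (B)+1 on a FIXED finite torus — NOT infinite volume, NOT a mass gap, NOT the Clay problem.
Census arithmetic on DISPLAYED binder shapes + ONE END-level composition BY NAME; discharges nothing about Bałaban's objects, asserts
nothing printed; NE9 NOT PRINTED / NOT PROVED («NE9 ⇐ the named binders»).  `FlowStep.BetaPertH`, (B), (B^μ) do not occur.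
HONEST DEPENDENCY (verbatim): continuum YM on T⁴ ⇐ BetaPertH ∧ nine spine estimates (0/9 proved); BetaPertH ⇐ (D1) ∧ (D4) ∧
CAP+tail; G-an2-4 gates asym, D1 and NE2/3/4.

WHAT THE SPECIES CHANGES.  On every d-currency END face of row NE9 the rate letter is `ω + 4·lipbar·B·τ̄` with the per-step channel
constant τ̄ a FREE letter; at the displayed species of [II] §1 (the (1.23)-pieces of the fifth-order Taylor remainder, owner parts
1–3 p212277/p212850/p213009, E5′-REM p213078) the profile is the kernel's `tauOfG c_Q (agePow ω)` and the face FIXES `τ̄ := c_Q`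
— in print `c_Q = (6L)⁴` ([II] p. 8 l. 9–10 «(6L)⁴L^jη … 2(6L)⁴»), `ω = L⁻¹` (gain exponent α = 1 for this family, O-ne9p1g23-1).
The budget question of this lineage (FINDING F-ne9leaf01-1 (P)) therefore acquires the factor (6L)⁴ ≈ 3.70·10⁷ at L = 13.

WHAT IS PROVED (kernel, `[folklore]`, 0 `def`, 0 sorry; imports E5′-REM (p213078) and this lineage's N2-quater scalars (p211624) BY NAME).
§1 SCALAR GLUE new to the species: `rateGap_le_of_KP` — under N2-quater's print-shaped KP smallness
   `2^(ν+1)·e·Dp·2^(2^ν)·2^(ν+1+2^ν)·ε̄·e^{a″(ν+1)} ≤ 1` the species' rate gap `8e·Dp·2^(2^ν)·(2^(ν+1+2^ν))²·ᾱ·ε̄·c_Q` is at most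
   `2^(3+2^ν)·ᾱ·c_Q·e^{−a″(ν+1)}`; `fade_remSpecies_iff` (the gap against `1 − ω`); `fade_remSpecies_of_KP` / `…_of_KP_log` (fading from
   the KP smallness once `log(2^(3+2^ν)·ᾱ·c_Q/(1 − ω)) < a″(ν+1)`).
§2 **E5′-REM IN PRINT-SHAPED LETTERS** `torus_termSize_ne9_and_fadingMemory_remSpecies_printShaped`: p213078 §1 with the bookkeeping
   scalars CHOSEN — `a₁ := a₁⋆ = 2e(D+1)·2^(2^ν)·2^(ν+1+2^ν)·ε̄·e^{a″(ν+1)}`, `lip k = lipbar := ᾱ·2^(ν+1+2^ν)` — so that `ha₁ hlip hlipb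
   hliplb hsmall hrate` are GONE; displayed instead `hε'b : ε′ k ≤ ε̄`, `hα4b : α4 k ≤ ᾱ`, `hαbar : 0 < ᾱ`, the ONE exponential smallness
   `hKP` and the ADDITIVE letter-free rate condition `a″ + 1 + 2^(ν+1)·log 2 + log(8ν) ≤ a′`, (N) with the exponential-free increment;
   conclusion with the POLYNOMIAL rate letter **`μ⋆ = ω + 8e(D+1)·2^(2^ν)·(2^(ν+1+2^ν))²·ᾱ·ε̄·c_Q`** — no `e^{a″}` anywhere; the
   species' binders (`RemData.Admissible`, S1 on the analytic class, (w16) additivity, the p. 8 counts) and the whole activity /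
   geometry side VERBATIM.
§3 T⁴ / PRINT NUMERALS (ν = 4, L = 13, c_Q = 78⁴ = 37 015 056): the gap constant `8·2^16·(2^21)² = 8·2^58`, the KP-route constant
   `2^(3+16) = 2^19`; **fading at the species ⇔ (D+1)·ᾱ·ε̄·(e·2^58·320 797 152) < 1**, the constant bracketed in `(2.5134, 2.51342)·10²⁶`;
   on the KP route `2^19·ᾱ·78⁴·e^{−5a″} < 12/13` HOLDS for `5a″ ≥ 31`, ᾱ ≤ 1, and FAILS at `5a″ = 30`, ᾱ = 1 (threshold
   `5a″ = log(2^21·10 024 911·ᾱ) ≈ 30.68`): the print-shaped KP smallness alone delivers fading once `a″ ≥ 6.2` (ᾱ ≤ 1); the species'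
   c_Q costs `4·log 78 ≈ 17.4` in `log ε̄` against τ̄ = 1.
§4 THE `_compProj` FACE AT THE SPECIES (owner part 3 p213009; rate `ω + 8·lipbar·B·((1 + c)·c_Q)`): `fade_compProjSpecies_iff`
   (`lipbar·B·(1 + c)·c_Q < (1 − ω)/8`) and its print corner `lipbar·B·(1 + c) < 1/320 797 152` at L = 13.
Second engine for every numeral: exact-rational sheet `HOME/t4/b2b-balaban-t4-ne9-formalise-leaf-01/g5/NE9RemSpeciesCensus.md`.

References (TYPE locators only; nothing printed is a hypothesis): T. Bałaban, CMP **116** (1988) [Balaban1988RG2Cluster] (1.22)–(1.29)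
pp. 7–8, p. 8 l. 9–10, (1.36) p. 9, p. 18 text, (2.38) p. 20, p. 21 text; CMP **109** (1987) [Balaban1987RG1] (0.29)–(0.30) p. 258,
(3.36) p. 277, (3.54) p. 280; R. Kotecký, D. Preiss, CMP **103** (1986) [KoteckyPreiss1986].
-/

noncomputable section

namespace Summit.QuantumFields.BalabanUV.T4Continuum.NE9LinSizeEndRemSpeciesBudget

open scoped BigOperators
open Metric Set MeasureTheory BoundedContinuousFunction
open Literature.Probability.LatticeModels
open Literature.MathematicalPhysics.QuantumFieldTheory
open Literature.MathematicalPhysics.QuantumFieldTheory.Balaban1983to89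
open Literature.MathematicalPhysics.QuantumFieldTheory.Balaban1983to89.T4OutputRate
open Literature.MathematicalPhysics.QuantumFieldTheory.Balaban1983to89.T4ActivityLipschitz
open Literature.MathematicalPhysics.QuantumFieldTheory.Balaban1983to89.T4HistoryLipschitzRecursion
open Literature.MathematicalPhysics.QuantumFieldTheory.Balaban1983to89.T4HistoryLipschitzOuter
open Literature.MathematicalPhysics.QuantumFieldTheory.Balaban1983to89.T4HistoryLipschitzActivity
open Literature.MathematicalPhysics.QuantumFieldTheory.Balaban1983to89.T4HistoryLipschitzEntropy
open Literature.MathematicalPhysics.QuantumFieldTheory.Balaban1983to89.T4HistoryLipschitzCubeGeometry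
open Literature.MathematicalPhysics.QuantumFieldTheory.Balaban1983to89.T4HistoryLipschitzActivity (ClusterGeom)
open Literature.MathematicalPhysics.QuantumFieldTheory.Balaban1983to89.T4HistoryLipschitzSegment
open Literature.MathematicalPhysics.QuantumFieldTheory.Balaban1983to89.T4HistoryLipschitzLinearSize
open Summit.QuantumFields.BalabanUV.T4Continuum.NE9Lemma1Counting
open Summit.QuantumFields.BalabanUV.T4Continuum.NE9Lemma1Gain
open Summit.QuantumFields.BalabanUV.T4Continuum.NE9Lemma1PieceClass
open Summit.QuantumFields.BalabanUV.T4Continuum.NE9ComplexEncoding (doubleCarriers)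
open Summit.QuantumFields.BalabanUV.T4Continuum.NE9Lemma1RemainderSpecies
open Summit.QuantumFields.BalabanUV.T4Continuum.NE9LinSizeEndRemSpecies
open Summit.QuantumFields.BalabanUV.T4Continuum.NE9LinSizeEndMultiScaleBudget

/-! ## §1 Scalar glue new to the species: the rate gap under the print-shaped KP smallness -/

section Scalars

variable {ν : ℕ} {Dp a'' εbar αbar cQ ω : ℝ}

/-- **THE SPECIES' RATE GAP UNDER THE PRINT-SHAPED KP SMALLNESS.**  With N2-quater's `hKP : 2^(ν+1)·e·Dp·2^(2^ν)·2^(ν+1+2^ν)·ε̄·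
e^{a″(ν+1)} ≤ 1` (TYPE [II] p. 18 «exp 5κ ≤ 1») the exponential-free rate gap of §2 obeys
`8e·Dp·2^(2^ν)·(2^(ν+1+2^ν))²·ᾱ·ε̄·c_Q ≤ 2^(3+2^ν)·ᾱ·c_Q·e^{−a″(ν+1)}` (`8·2^(ν+1+2^ν) = 2^(3+2^ν)·2^(ν+1)`). [folklore] -/
theorem rateGap_le_of_KP (hαbar : 0 ≤ αbar) (hcQ : 0 ≤ cQ)
    (hKP : 2 ^ (ν + 1) * Real.exp 1 * Dp * (2:ℝ) ^ (2 ^ ν) * 2 ^ (ν + 1 + 2 ^ ν) * εbar * Real.exp (a'' * (ν + 1)) ≤ 1) :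
    8 * Real.exp 1 * Dp * (2:ℝ) ^ (2 ^ ν) * (2 ^ (ν + 1 + 2 ^ ν)) ^ 2 * αbar * εbar * cQ ≤
      2 ^ (3 + 2 ^ ν) * αbar * cQ * Real.exp (-(a'' * (ν + 1))) := by
  have hE : 0 < Real.exp (-(a'' * (ν + 1))) := Real.exp_pos _
  have hcancel : Real.exp (a'' * (ν + 1)) * Real.exp (-(a'' * (ν + 1))) = 1 := by
    rw [← Real.exp_add, add_neg_cancel, Real.exp_zero]
  have hX : 2 ^ (ν + 1) * Real.exp 1 * Dp * (2:ℝ) ^ (2 ^ ν) * 2 ^ (ν + 1 + 2 ^ ν) * εbar ≤ Real.exp (-(a'' * (ν + 1))) := by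
    have h1 := mul_le_mul_of_nonneg_right hKP hE.le
    rw [one_mul] at h1
    calc 2 ^ (ν + 1) * Real.exp 1 * Dp * (2:ℝ) ^ (2 ^ ν) * 2 ^ (ν + 1 + 2 ^ ν) * εbar
        = 2 ^ (ν + 1) * Real.exp 1 * Dp * (2:ℝ) ^ (2 ^ ν) * 2 ^ (ν + 1 + 2 ^ ν) * εbar *
            (Real.exp (a'' * (ν + 1)) * Real.exp (-(a'' * (ν + 1)))) := by rw [hcancel, mul_one]
      _ = 2 ^ (ν + 1) * Real.exp 1 * Dp * (2:ℝ) ^ (2 ^ ν) * 2 ^ (ν + 1 + 2 ^ ν) * εbar * Real.exp (a'' * (ν + 1)) *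
            Real.exp (-(a'' * (ν + 1))) := by ring
      _ ≤ Real.exp (-(a'' * (ν + 1))) := h1
  have hP : (2:ℝ) ^ (ν + 1 + 2 ^ ν) = 2 ^ (ν + 1) * 2 ^ (2 ^ ν) := by rw [pow_add]
  have h8 : (2:ℝ) ^ (3 + 2 ^ ν) = 8 * 2 ^ (2 ^ ν) := by rw [pow_add]; norm_num
  have hId : 8 * Real.exp 1 * Dp * (2:ℝ) ^ (2 ^ ν) * (2 ^ (ν + 1 + 2 ^ ν)) ^ 2 * αbar * εbar * cQ =
      (2 ^ (3 + 2 ^ ν) * αbar * cQ) *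
        (2 ^ (ν + 1) * Real.exp 1 * Dp * (2:ℝ) ^ (2 ^ ν) * 2 ^ (ν + 1 + 2 ^ ν) * εbar) := by
    rw [h8, hP]; ring
  have hC : 0 ≤ (2:ℝ) ^ (3 + 2 ^ ν) * αbar * cQ := by positivity
  rw [hId]
  calc (2:ℝ) ^ (3 + 2 ^ ν) * αbar * cQ * (2 ^ (ν + 1) * Real.exp 1 * Dp * (2:ℝ) ^ (2 ^ ν) * 2 ^ (ν + 1 + 2 ^ ν) * εbar)
      ≤ 2 ^ (3 + 2 ^ ν) * αbar * cQ * Real.exp (-(a'' * (ν + 1))) := mul_le_mul_of_nonneg_left hX hC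

/-- **FADING AT THE SPECIES** is the gap condition `8e·Dp·2^(2^ν)·(2^(ν+1+2^ν))²·ᾱ·ε̄·c_Q < 1 − ω`, i.e. a CEILING on the product
`Dp·ᾱ·ε̄·c_Q` (`T4HistoryLipschitzSegment.fade_iff`'s reading at the polynomial letter). [folklore] -/
theorem fade_remSpecies_iff :
    ω + 8 * Real.exp 1 * Dp * (2:ℝ) ^ (2 ^ ν) * (2 ^ (ν + 1 + 2 ^ ν)) ^ 2 * αbar * εbar * cQ < 1 ↔
      Dp * αbar * εbar * cQ < (1 - ω) / (8 * Real.exp 1 * (2:ℝ) ^ (2 ^ ν) * (2 ^ (ν + 1 + 2 ^ ν)) ^ 2) := by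
  have hK : 0 < 8 * Real.exp 1 * (2:ℝ) ^ (2 ^ ν) * (2 ^ (ν + 1 + 2 ^ ν)) ^ 2 := by positivity
  rw [lt_div_iff₀ hK]
  have e : 8 * Real.exp 1 * Dp * (2:ℝ) ^ (2 ^ ν) * (2 ^ (ν + 1 + 2 ^ ν)) ^ 2 * αbar * εbar * cQ =
      Dp * αbar * εbar * cQ * (8 * Real.exp 1 * (2:ℝ) ^ (2 ^ ν) * (2 ^ (ν + 1 + 2 ^ ν)) ^ 2) := by ring
  rw [e]
  constructor <;> intro h <;> linarith

/-- **THE KP SMALLNESS DELIVERS FADING** once `2^(3+2^ν)·ᾱ·c_Q·e^{−a″(ν+1)} < 1 − ω`. [folklore] -/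
theorem fade_remSpecies_of_KP (hαbar : 0 ≤ αbar) (hcQ : 0 ≤ cQ)
    (hKP : 2 ^ (ν + 1) * Real.exp 1 * Dp * (2:ℝ) ^ (2 ^ ν) * 2 ^ (ν + 1 + 2 ^ ν) * εbar * Real.exp (a'' * (ν + 1)) ≤ 1)
    (hgap : 2 ^ (3 + 2 ^ ν) * αbar * cQ * Real.exp (-(a'' * (ν + 1))) < 1 - ω) :
    ω + 8 * Real.exp 1 * Dp * (2:ℝ) ^ (2 ^ ν) * (2 ^ (ν + 1 + 2 ^ ν)) ^ 2 * αbar * εbar * cQ < 1 := by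
  have := rateGap_le_of_KP (cQ := cQ) hαbar hcQ hKP
  linarith

/-- … in LOGARITHMIC form: for `ω < 1` and `ᾱ·c_Q > 0`, the KP smallness delivers fading as soon as
`log(2^(3+2^ν)·ᾱ·c_Q / (1 − ω)) < a″·(ν+1)` — TYPE «κ sufficiently large» ([II] p. 8, p. 18), the species' share being `log c_Q`.
[folklore] -/
theorem fade_remSpecies_of_KP_log (hαbar : 0 < αbar) (hcQ : 0 < cQ) (hω : ω < 1)
    (hKP : 2 ^ (ν + 1) * Real.exp 1 * Dp * (2:ℝ) ^ (2 ^ ν) * 2 ^ (ν + 1 + 2 ^ ν) * εbar * Real.exp (a'' * (ν + 1)) ≤ 1)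
    (hlog : Real.log (2 ^ (3 + 2 ^ ν) * αbar * cQ / (1 - ω)) < a'' * (ν + 1)) :
    ω + 8 * Real.exp 1 * Dp * (2:ℝ) ^ (2 ^ ν) * (2 ^ (ν + 1 + 2 ^ ν)) ^ 2 * αbar * εbar * cQ < 1 := by
  refine fade_remSpecies_of_KP hαbar.le hcQ.le hKP ?_
  have h1ω : 0 < 1 - ω := by linarith
  have hM : 0 < (2:ℝ) ^ (3 + 2 ^ ν) * αbar * cQ := by positivity
  have h2 : (2:ℝ) ^ (3 + 2 ^ ν) * αbar * cQ / (1 - ω) < Real.exp (a'' * (ν + 1)) := by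
    calc (2:ℝ) ^ (3 + 2 ^ ν) * αbar * cQ / (1 - ω) = Real.exp (Real.log (2 ^ (3 + 2 ^ ν) * αbar * cQ / (1 - ω))) :=
        (Real.exp_log (div_pos hM h1ω)).symm
      _ < Real.exp (a'' * (ν + 1)) := Real.exp_lt_exp.2 hlog
  rw [div_lt_iff₀ h1ω] at h2
  have hE : 0 < Real.exp (-(a'' * (ν + 1))) := Real.exp_pos _
  have hcancel : Real.exp (a'' * (ν + 1)) * Real.exp (-(a'' * (ν + 1))) = 1 := by
    rw [← Real.exp_add, add_neg_cancel, Real.exp_zero]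
  calc (2:ℝ) ^ (3 + 2 ^ ν) * αbar * cQ * Real.exp (-(a'' * (ν + 1)))
      < Real.exp (a'' * (ν + 1)) * (1 - ω) * Real.exp (-(a'' * (ν + 1))) := mul_lt_mul_of_pos_right h2 hE
    _ = (1 - ω) * (Real.exp (a'' * (ν + 1)) * Real.exp (-(a'' * (ν + 1)))) := by ring
    _ = 1 - ω := by rw [hcancel, mul_one]

end Scalars

/-! ## §2 E5′-REM IN PRINT-SHAPED LETTERS -/

section Species

variable {ν N : ℕ} {C : Carriers} {D : ℕ}
variable {Bg : Type} [NormedAddCommGroup Bg] [NormedSpace ℂ Bg] {Sp : Type*} [TopologicalSpace Sp] [MeasurableSpace Sp]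
  [OpensMeasurableSpace Sp] {F : Type*} [Fintype F] {Ω : Type*} [MeasurableSpace Ω]

/-- **E5′-REM IN PRINT-SHAPED LETTERS (kernel end-to-end).**  E5′-REM (p213078 §1: the d-currency torus END of row NE9 at the
displayed species on the analytic class, S2/S5 KERNEL) with its bookkeeping scalars CHOSEN — `a₁ := a₁⋆ = 2e(D+1)·2^(2^ν)·2^(ν+1+2^ν)·
ε̄·e^{a″(ν+1)}`, `lip k = lipbar := ᾱ·2^(ν+1+2^ν)` — so that `a₁ lip lipbar` and the binders `ha₁ hlip hlipb hliplb hsmall hrate` are GONE;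
DISPLAYED instead: `hε'b : ε′ k ≤ ε̄`, `hα4b : α4 k ≤ ᾱ`, `hαbar : 0 < ᾱ`, the ONE exponential smallness **`hKP : 2^(ν+1)·e·(D+1)·2^(2^ν)·
2^(ν+1+2^ν)·ε̄·e^{a″(ν+1)} ≤ 1`** (TYPE [II] p. 18 «exp 5κ ≤ 1», ν + 1 = 5), the ADDITIVE letter-free rate condition **`hrate : a″ + 1 +
2^(ν+1)·log 2 + log(8ν) ≤ a′`**, and (N) with the exponential-free increment `2e(D+1)·2^(2^ν)·2^(ν+1+2^ν)·ε̄` (TYPE p. 21 «O(1)C₃ε₁ ≦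
½E₀»); the species' binders (`hD` = `RemData.Admissible`: domain inclusion (I.3.36), radii, G1; S1 `hAdm` on the analytic class; (w16)
additivity `hA`; the p. 8 counts `hLev`; `hO1 hcQ hω`) and every recursion / activity / geometry binder of E5′-REM VERBATIM.  Conclusion:
`TermSize` and the END with the POLYNOMIAL rate letter **`μ⋆ = ω + 8e(D+1)·2^(2^ν)·(2^(ν+1+2^ν))²·ᾱ·ε̄·c_Q`** — the species FIXES
τ̄ := c_Q (print: (6L)⁴).  Composition BY NAME: p213078 ∘ N2-quater §1 (`smallness_of_printShaped`, `rate_of_printShaped`, `aStar_envelope`,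
`rateLetter_printShaped`).  Nothing of [I]/[II] asserted; rung (B)+1 bookkeeping on a finite torus.
[cite: Balaban1988RG2Cluster, (1.23)-(1.29) pp.7-8, p.18 text, (2.38) p.20, p.21 text; Balaban1987RG1, (3.36) p.277, (3.54) p.280; KoteckyPreiss1986, (1)-(3)] -/
theorem torus_termSize_ne9_and_fadingMemory_remSpecies_printShaped
    (Γ : CubeChart (doubleCarriers C) (Fin ν → ZMod N) (torusAdj ν N) D) {ι αi βi γi δ : Type} [DecidableEq δ]
    (Dd : RemData C Bg ι αi βi γi δ) {ℓr : ℕ → ℕ → ℝ} {cdir d0 : ℝ}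
    {E : Functional (doubleCarriers C) Bg} {W : Set (ℕ → ℝ)}
    {Ψ : ℕ → ℝ → (ι → ℝ) → Bg → (doubleCarriers C).Dom → ℝ}
    {μ : ℕ → ℝ → Bg → Finset (Fin ν → ZMod N) → Measure Ω} {pre : ℕ → ℝ → Bg → Finset (Fin ν → ZMod N) → Ω → ℂ}
    {c : ℕ → ℝ → Bg → Finset (Fin ν → ZMod N) → Ω → F → ℂ}
    {pt : ℕ → ℝ → Bg → Finset (Fin ν → ZMod N) → Ω → F → Sp} {β : ℕ → Sp → ℝ}
    {dom : ℕ → Finset (Fin ν → ZMod N) → F → Finset (Fin ν → ZMod N)}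
    {ε' α4 : ℕ → ℝ} {a'' κ O1 cQ ω ℓ a a' εbar αbar : ℝ}
    {lam p₀ Nsz : ℕ → ℝ}
    (ρ : ℕ → (ι → ℝ) → (Sp →ᵇ ℂ))
    -- the DISPLAYED SPECIES: admissible datum ((I.3.36) domain inclusion, radii, G1 — TYPE), scale letter ℓr ≥ 0
    (hD : Dd.Admissible ℓr cdir d0) (hℓr : ∀ k j, 0 ≤ ℓr k j)
    -- S1 on the analytic class ([I] (1.18) — TYPE), scale-zero freeness, (w16) additivity (displayed), the p. 8 counts and letters
    (h0 : ScaleZeroFree E W) (hAdm : AdmissibleTerms E W (analyticClass Dd.R))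
    (hA : PieceAdditiveOn (analyticClass Dd.R) Dd.toC)
    (hLev : LevelCountsG Dd.toC.frame κ Dd.κ₁ O1 cQ (fun k j => ℓr k j ^ 5) (agePow ω))
    (hO1 : 0 ≤ O1) (hcQ : 0 ≤ cQ) (hω : 0 < ω)
    -- E5′'s recursion-side binders at `T := cpieceChannel Dd.toC`, `wt := weightOf Dd.toC.frame Dd.κ₁ d0 O1 (KpOf Dd cdir)` (verbatim)
    (hfac : Factorises E W (cpieceChannel Dd.toC) Ψ) (hlast : LastCouplingLipschitz E W (cpieceChannel Dd.toC) Ψ κ lam)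
    (hρ : ∀ (k : ℕ) (Q Q' : ι → ℝ) (M : ℝ), (∀ y, |Q y - Q' y| ≤ weightOf Dd.toC.frame Dd.κ₁ d0 O1 (KpOf Dd cdir) k y * M) →
      ‖ρ k Q - ρ k Q'‖ ≤ M)
    (hΨ : ∀ (k : ℕ) (s : ℝ) (Q Q' : ι → ℝ) (U : Bg) (X : (doubleCarriers C).Dom),
      Ψ k s Q U X - Ψ k s Q' U X =
        (Γ.geom.newTerm (Γ.geom.avgExpLinearAct μ pre fun k s U γ ω => evalFunctional (c k s U γ ω) (pt k s U γ ω))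
            k s U X (ρ k Q) -
          Γ.geom.newTerm (Γ.geom.avgExpLinearAct μ pre fun k s U γ ω => evalFunctional (c k s U γ ω) (pt k s U γ ω))
            k s U X (ρ k Q')).re)
    (hexpl : ∀ g ∈ W, ∀ (k : ℕ) (Q : ι → ℝ) (U : Bg) (X : (doubleCarriers C).Dom), (doubleCarriers C).scale X = k + 1 →
      |Ψ k (g k) Q U X -
          (Γ.geom.newTerm (Γ.geom.avgExpLinearAct μ pre fun k s U γ ω => evalFunctional (c k s U γ ω) (pt k s U γ ω))
            k (g k) U X (ρ k Q)).re| ≤ Real.exp (-(κ * (doubleCarriers C).d X)) * p₀ k)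
    (hbase : ∀ g ∈ W, ∀ (U : Bg) (X : (doubleCarriers C).Dom), (doubleCarriers C).scale X = 0 →
      |E g U X| ≤ Real.exp (-(κ * (doubleCarriers C).d X)) * Nsz 0)
    -- (N) with the EXPONENTIAL-FREE increment B = 2e(D+1)·2^(2^ν)·2^(ν+1+2^ν)·ε̄
    (hNsucc : ∀ j, p₀ j + 2 * Real.exp 1 * ((D : ℝ) + 1) * (2:ℝ) ^ (2 ^ ν) * 2 ^ (ν + 1 + 2 ^ ν) * εbar ≤ Nsz (j + 1))
    (hNnn : ∀ j, 0 ≤ Nsz j)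
    (hbox : ∀ (k : ℕ) (Q : ι → ℝ),
      (∀ y, |Q y| ≤ weightOf Dd.toC.frame Dd.κ₁ d0 O1 (KpOf Dd cdir) k y * sizeRadius (tauOfG cQ (agePow ω)) Nsz k) →
        ∀ x, ‖ρ k Q x‖ ≤ β k x)
    -- activity side: regularity data, ONE integrability, support of the coefficients (verbatim)
    (hpre : ∀ k s U γ, AEStronglyMeasurable (pre k s U γ) (μ k s U γ))
    (hc : ∀ k s U γ Y, AEStronglyMeasurable (fun ω => c k s U γ ω Y) (μ k s U γ))
    (hpt : ∀ k s U γ Y, Measurable fun ω => pt k s U γ ω Y)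
    (hint₀ : ∀ k s U γ, Integrable (fun ω => ‖pre k s U γ ω‖ * Real.exp (boxExponent c pt β k s U γ ω)) (μ k s U γ))
    (hmeet : ∀ k s U (γ : Finset (Fin ν → ZMod N)) ω Y, c k s U γ ω Y ≠ 0 → ∃ x ∈ γ, x ∈ dom k γ Y)
    -- (L‴) the coefficient tables with a SUP LETTER ᾱ for their scale (TYPE [II] (2.20): α₄ is one constant)
    (hα4 : ∀ k, 0 ≤ α4 k) (hα4b : ∀ k, α4 k ≤ αbar) (hαbar : 0 < αbar)
    (ha : (2:ℝ) ^ ν * Real.log 2 + Real.log (8 * ν) ≤ a)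
    (hlin : ∀ k s U (γ : Finset (Fin ν → ZMod N)) ω Y,
      ‖c k s U γ ω Y‖ ≤ α4 k * Real.exp (-(a * (linSize (dom k γ Y) : ℝ))))
    (hdomconn : ∀ k (γ : Finset (Fin ν → ZMod N)) Y, (dom k γ Y).Nonempty →
      ∃ b ∈ dom k γ Y, Polymer.IsConn (torusAdj ν N) (dom k γ Y) b)
    (hdominj : ∀ k (γ : Finset (Fin ν → ZMod N)), Set.InjOn (dom k γ) {Y | (dom k γ Y).Nonempty})
    (hXconn : ∀ X, ∃ b, Polymer.IsConn (torusAdj ν N) (Γ.cubes X) b)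
    (hcmp : ∀ X, κ * (doubleCarriers C).d X ≤ a'' * (linSize (Γ.cubes X) : ℝ))
    -- (A″) the box majorant in d_k with a SUP LETTER ε̄ for its scale (ε₁ is one constant)
    (hε' : ∀ k, 0 ≤ ε' k) (hε'b : ∀ k, ε' k ≤ εbar)
    (hdecayLin : ∀ g ∈ W, ∀ (k : ℕ) (U : Bg) (X : (doubleCarriers C).Dom), (doubleCarriers C).scale X = k + 1 → ∀ γ' ∈ Γ.vol X,
      ∫ ω, ‖pre k (g k) U γ' ω‖ * Real.exp (boxExponent c pt β k (g k) U γ' ω) ∂(μ k (g k) U γ') ≤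
        ε' k * Real.exp (-(a' * (linSize γ' : ℝ))))
    (ha'' : 0 ≤ a'')
    -- THE PRINT-SHAPED SCALARS: the one exponential smallness and the ADDITIVE letter-free rate condition
    (hKP : 2 ^ (ν + 1) * Real.exp 1 * ((D : ℝ) + 1) * (2:ℝ) ^ (2 ^ ν) * 2 ^ (ν + 1 + 2 ^ ν) * εbar *
      Real.exp (a'' * (ν + 1)) ≤ 1)
    (hrate : a'' + 1 + 2 ^ (ν + 1) * Real.log 2 + Real.log (8 * ν) ≤ a')
    (hℓ : 0 ≤ ℓ) (hlam : ∀ k, lam k ≤ ℓ) :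
    TermSize E W κ Nsz ∧
      NE9 E W κ (prodModuli ℓ fun _ =>
        ω + 8 * Real.exp 1 * ((D : ℝ) + 1) * (2:ℝ) ^ (2 ^ ν) * (2 ^ (ν + 1 + 2 ^ ν)) ^ 2 * αbar * εbar * cQ) ∧
        FadingMemory
          (ℓ / (ω + 8 * Real.exp 1 * ((D : ℝ) + 1) * (2:ℝ) ^ (2 ^ ν) * (2 ^ (ν + 1 + 2 ^ ν)) ^ 2 * αbar * εbar * cQ))
          (ω + 8 * Real.exp 1 * ((D : ℝ) + 1) * (2:ℝ) ^ (2 ^ ν) * (2 ^ (ν + 1 + 2 ^ ν)) ^ 2 * αbar * εbar * cQ)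
          (prodModuli ℓ fun _ =>
            ω + 8 * Real.exp 1 * ((D : ℝ) + 1) * (2:ℝ) ^ (2 ^ ν) * (2 ^ (ν + 1 + 2 ^ ν)) ^ 2 * αbar * εbar * cQ) := by
  have hDp : (0:ℝ) ≤ (D : ℝ) + 1 := by positivity
  have hP0 : (0:ℝ) < 2 ^ (ν + 1 + 2 ^ ν) := by positivity
  -- the chosen KP size constant `a₁⋆` and its discharged binders (N2-quater §1 BY NAME)
  have hA0 : 0 ≤ 2 * Real.exp 1 * ((D : ℝ) + 1) * (2:ℝ) ^ (2 ^ ν) * 2 ^ (ν + 1 + 2 ^ ν) * εbar *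
      Real.exp (a'' * (ν + 1)) := by
    have hεbar : 0 ≤ εbar := (hε' 0).trans (hε'b 0)
    positivity
  have hsmall := fun k => smallness_of_printShaped (ν := ν) hDp (hε' k) (hε'b k) hKP
  have hrate' := rate_of_printShaped (ν := ν) hKP hrate
  have eμ := rateLetter_printShaped ν ((D : ℝ) + 1) a'' εbar αbar cQ ω
  have h := torus_termSize_ne9_and_fadingMemory_of_linSizeDischargers_remSpecies Γ Dd ρ hD hℓr h0 hAdm hA hLev hO1 hcQ hω hfac
    hlast hρ hΨ hexpl hbase (fun j => by rw [aStar_envelope]; exact hNsucc j) hNnn hbox hpre hc hpt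
    (lip := fun _ => αbar * 2 ^ (ν + 1 + 2 ^ ν)) (lipbar := αbar * 2 ^ (ν + 1 + 2 ^ ν))
    (fun _ => mul_pos hαbar hP0) (fun _ => le_rfl) hint₀ hmeet hα4 ha
    (fun k => mul_le_mul_of_nonneg_right (hα4b k) hP0.le) hlin hdomconn hdominj hXconn hcmp hε' hdecayLin hA0 ha'' hrate' hsmall
    hℓ hlam
  rw [eμ] at h
  exact h

end Species

/-! ## §3 T⁴ / print numerals (ν = 4, L = 13, c_Q = (6L)⁴ = 78⁴): pure numbers -/

/-- On T⁴ the species' gap constant reads `8·2^16·(2^21)² = 8·2^58` and the KP-route constant `2^(3+16) = 2^19`; print's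
`c_Q = (6·13)⁴ = 37 015 056`. [folklore] -/
theorem T4_species_shapes :
    (8:ℝ) * (2:ℝ) ^ (2 ^ (4:ℕ)) * ((2:ℝ) ^ ((4:ℕ) + 1 + 2 ^ (4:ℕ))) ^ 2 = 8 * 2 ^ 58 ∧
      (2:ℝ) ^ (3 + 2 ^ (4:ℕ)) = 2 ^ 19 ∧ ((6:ℝ) * 13) ^ 4 = 37015056 := by
  refine ⟨by norm_num, by norm_num, by norm_num⟩

/-- **THE SPECIES' FADING CONDITION ON T⁴ AT PRINT'S LETTERS** (`ω = 1/13`, `c_Q = 78⁴`): `μ⋆ < 1 ↔ (D+1)·ᾱ·ε̄·(e·2^58·320 797 152)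
< 1` (`13·8·78⁴/12 = 320 797 152`). [folklore] -/
theorem fade_remSpecies_T4_L13_iff {Dp αbar εbar : ℝ} :
    (13:ℝ)⁻¹ + 8 * Real.exp 1 * Dp * (2:ℝ) ^ (2 ^ (4:ℕ)) * ((2:ℝ) ^ ((4:ℕ) + 1 + 2 ^ (4:ℕ))) ^ 2 * αbar * εbar *
        ((6:ℝ) * 13) ^ 4 < 1 ↔
      Dp * αbar * εbar * (Real.exp 1 * 2 ^ 58 * 320797152) < 1 := by
  have e : 8 * Real.exp 1 * Dp * (2:ℝ) ^ (2 ^ (4:ℕ)) * ((2:ℝ) ^ ((4:ℕ) + 1 + 2 ^ (4:ℕ))) ^ 2 * αbar * εbar *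
      ((6:ℝ) * 13) ^ 4 = (12 / 13) * (Dp * αbar * εbar * (Real.exp 1 * 2 ^ 58 * 320797152)) := by
    ring
  rw [e]
  constructor <;> intro h <;> linarith

/-- The fading constant of T⁴ at print's letters: `e·2^58·320 797 152 ∈ (2.5134·10²⁶, 2.51342·10²⁶)` — fading at the displayed
species asks **`(D+1)·ᾱ·ε̄ < 3.98·10⁻²⁷`** (`Real.exp_one_gt_d9` / `_lt_d9`; second engine: the census sheet). [folklore] -/
theorem speciesFadeConst_bracket :
    (2.5134e26 : ℝ) < Real.exp 1 * 2 ^ 58 * 320797152 ∧ Real.exp 1 * 2 ^ 58 * 320797152 < (2.51342e26 : ℝ) := by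
  have h1 : (2.7182818283 : ℝ) < Real.exp 1 := Real.exp_one_gt_d9
  have h2 : Real.exp 1 < 2.7182818286 := Real.exp_one_lt_d9
  constructor <;> nlinarith

/-- **THE KP ROUTE ON T⁴ SUFFICES FROM `5a″ ≥ 31`** (ᾱ ≤ 1): `2^19·ᾱ·78⁴·e^{−5a″} < 12/13` — §1's `hgap` at print's letters
(`e^{31} > 2.7^{31} > 2^21·10 024 911 = 2^19·78⁴·13/12`). [folklore] -/
theorem kpRoute_T4_L13 {αbar t : ℝ} (hαbar : 0 ≤ αbar) (hαbar1 : αbar ≤ 1) (ht : 31 ≤ t) :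
    (2:ℝ) ^ 19 * αbar * ((6:ℝ) * 13) ^ 4 * Real.exp (-t) < 1 - (13:ℝ)⁻¹ := by
  have he : (2.7 : ℝ) ≤ Real.exp 1 := by have := Real.exp_one_gt_d9; linarith
  have e31 : Real.exp 1 ^ 31 = Real.exp 31 := by rw [Real.exp_one_pow]; norm_num
  have h31 : (2.7 : ℝ) ^ 31 ≤ Real.exp 31 := by
    rw [← e31]
    exact pow_le_pow_left₀ (by norm_num) he 31
  have hexp : Real.exp (-t) ≤ ((2.7 : ℝ) ^ 31)⁻¹ := by
    rw [Real.exp_neg]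
    exact inv_anti₀ (by norm_num) (h31.trans (Real.exp_le_exp.2 ht))
  have hK : 0 ≤ (2:ℝ) ^ 19 * αbar * ((6:ℝ) * 13) ^ 4 := by positivity
  have hI : 0 ≤ ((2.7 : ℝ) ^ 31)⁻¹ := by positivity
  calc (2:ℝ) ^ 19 * αbar * ((6:ℝ) * 13) ^ 4 * Real.exp (-t)
      ≤ (2:ℝ) ^ 19 * αbar * ((6:ℝ) * 13) ^ 4 * ((2.7 : ℝ) ^ 31)⁻¹ := mul_le_mul_of_nonneg_left hexp hK
    _ ≤ (2:ℝ) ^ 19 * 1 * ((6:ℝ) * 13) ^ 4 * ((2.7 : ℝ) ^ 31)⁻¹ := by gcongr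
    _ < 1 - (13:ℝ)⁻¹ := by norm_num

/-- … and FAILS at `5a″ = 30`, ᾱ = 1: `2^19·78⁴·e^{−30} ≥ 12/13` (`e^{30} < 2.72^{30} < 2^21·10 024 911`) — the KP-route threshold
`5a″ = log(2^21·10 024 911) ≈ 30.68` lies in `(30, 31)`: a″ ≥ 6.2 suffices, a″ ≤ 6 does not, by this route. [folklore] -/
theorem kpRoute_T4_L13_fails_at_thirty : ¬ ((2:ℝ) ^ 19 * 1 * ((6:ℝ) * 13) ^ 4 * Real.exp (-30) < 1 - (13:ℝ)⁻¹) := by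
  have he : Real.exp 1 ≤ (2.72 : ℝ) := by have := Real.exp_one_lt_d9; linarith
  have e30 : Real.exp 1 ^ 30 = Real.exp 30 := by rw [Real.exp_one_pow]; norm_num
  have h30 : Real.exp 30 ≤ (2.72 : ℝ) ^ 30 := by
    rw [← e30]
    exact pow_le_pow_left₀ (Real.exp_pos 1).le he 30
  have hexp : ((2.72 : ℝ) ^ 30)⁻¹ ≤ Real.exp (-30) := by
    rw [Real.exp_neg]
    exact inv_anti₀ (Real.exp_pos 30) h30
  have hK : 0 ≤ (2:ℝ) ^ 19 * 1 * ((6:ℝ) * 13) ^ 4 := by positivity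
  have hlow : (2:ℝ) ^ 19 * 1 * ((6:ℝ) * 13) ^ 4 * ((2.72 : ℝ) ^ 30)⁻¹ ≤
      (2:ℝ) ^ 19 * 1 * ((6:ℝ) * 13) ^ 4 * Real.exp (-30) := mul_le_mul_of_nonneg_left hexp hK
  have hnum : 1 - (13:ℝ)⁻¹ ≤ (2:ℝ) ^ 19 * 1 * ((6:ℝ) * 13) ^ 4 * ((2.72 : ℝ) ^ 30)⁻¹ := by norm_num
  exact not_lt.2 (hnum.trans hlow)

/-- The species' SHARE of the KP-route threshold: `log c_Q = 4·log 78` out of `5a″ ≈ 30.68`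
— bracketed `17.4 < 4·log 78 < 17.5` (`e^{87} < (78⁴)⁵`, `(78⁴)² < e^{35}` via `Real.exp_one_lt_d9` / `_gt_d9`). [folklore] -/
theorem log_cQ_bracket : (17.4 : ℝ) < 4 * Real.log 78 ∧ 4 * Real.log 78 < 17.5 := by
  have hlog : 4 * Real.log 78 = Real.log ((78:ℝ) ^ 4) := by rw [Real.log_pow]; norm_num
  rw [hlog]
  constructor
  · -- `e^{17.4} < 78⁴` from `(e^{17.4})⁵ = e^{87} < 2.7182818286^{87} < (78⁴)⁵`
    have h : Real.exp (17.4 : ℝ) < (78:ℝ) ^ 4 := by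
      have he : Real.exp 1 < (2.7182818286 : ℝ) := Real.exp_one_lt_d9
      have h5 : Real.exp (17.4 : ℝ) ^ 5 = Real.exp 87 := by
        rw [← Real.exp_nat_mul]; congr 1; norm_num
      have e87 : Real.exp 1 ^ 87 = Real.exp 87 := by rw [Real.exp_one_pow]; norm_num
      have h87 : Real.exp 87 < (2.7182818286 : ℝ) ^ 87 := by
        rw [← e87]; exact pow_lt_pow_left₀ he (Real.exp_pos 1).le (by norm_num)
      have hcmp : (2.7182818286 : ℝ) ^ 87 < ((78:ℝ) ^ 4) ^ 5 := by norm_num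
      have hlt : Real.exp (17.4 : ℝ) ^ 5 < ((78:ℝ) ^ 4) ^ 5 := by rw [h5]; exact h87.trans hcmp
      exact lt_of_pow_lt_pow_left₀ 5 (by positivity) hlt
    have := Real.log_lt_log (Real.exp_pos _) h
    rwa [Real.log_exp] at this
  · -- `78⁴ < e^{17.5}` from `(78⁴)² < 2.7182818283^{35} < e^{35} = (e^{17.5})²`
    have h : (78:ℝ) ^ 4 < Real.exp (17.5 : ℝ) := by
      have he : (2.7182818283 : ℝ) < Real.exp 1 := Real.exp_one_gt_d9
      have h2 : Real.exp (17.5 : ℝ) ^ 2 = Real.exp 35 := by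
        rw [← Real.exp_nat_mul]; congr 1; norm_num
      have e35 : Real.exp 1 ^ 35 = Real.exp 35 := by rw [Real.exp_one_pow]; norm_num
      have h35 : (2.7182818283 : ℝ) ^ 35 < Real.exp 35 := by
        rw [← e35]; exact pow_lt_pow_left₀ he (by norm_num) (by norm_num)
      have hcmp : ((78:ℝ) ^ 4) ^ 2 < (2.7182818283 : ℝ) ^ 35 := by norm_num
      have hlt : ((78:ℝ) ^ 4) ^ 2 < Real.exp (17.5 : ℝ) ^ 2 := by rw [h2]; exact hcmp.trans h35
      exact lt_of_pow_lt_pow_left₀ 2 (Real.exp_pos _).le hlt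
    have := Real.log_lt_log (by positivity) h
    rwa [Real.log_exp] at this

/-! ## §4 The `_compProj` face at the species (owner part 3, p213009): the budget on `lipbar·B·(1 + c)` -/

/-- On the marginal-projection face at the displayed species the rate is `ω + 8·lipbar·B·((1 + c)·c_Q)` (p213009); it fades iff
`lipbar·B·(1 + c)·c_Q < (1 − ω)/8`. [folklore] -/
theorem fade_compProjSpecies_iff {ω lipbar B c cQ : ℝ} :
    ω + 8 * lipbar * B * ((1 + c) * cQ) < 1 ↔ lipbar * B * (1 + c) * cQ < (1 - ω) / 8 := by
  rw [lt_div_iff₀ (by norm_num : (0:ℝ) < 8)]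
  have e : 8 * lipbar * B * ((1 + c) * cQ) = lipbar * B * (1 + c) * cQ * 8 := by ring
  rw [e]
  constructor <;> intro h <;> linarith

/-- … at print's letters (`ω = 1/13`, `c_Q = 78⁴`): **`lipbar·B·(1 + c) < 1/320 797 152`** (≈ 3.12·10⁻⁹) — the activity burden the
species leaves to the pin budget `B` and the activity Lipschitz sup `lipbar` on that face. [folklore] -/
theorem fade_compProjSpecies_L13_iff {lipbar B c : ℝ} :
    (13:ℝ)⁻¹ + 8 * lipbar * B * ((1 + c) * ((6:ℝ) * 13) ^ 4) < 1 ↔ lipbar * B * (1 + c) < 1 / 320797152 := by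
  have e : 8 * lipbar * B * ((1 + c) * ((6:ℝ) * 13) ^ 4) = (12 / 13) * (320797152 * (lipbar * B * (1 + c))) := by ring
  rw [e]
  constructor <;> intro h <;> linarith

end Summit.QuantumFields.BalabanUV.T4Continuum.NE9LinSizeEndRemSpeciesBudget

end
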